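import Summits.Ventures.Crystal3D.Kissing125.GSearchCheck1
import Summits.Ventures.Crystal3D.Kissing125.SearchDefs1
import HarnessLib

/-!
# Structures, codes and semantics of the growth search, κ-generic — part 1/3

HONEST FRAMING (cell pub-crystal3d, K-path at `h = 5/4`, V4 = κ as an explicit parameter): this is NOT a result printed
by Hales; it is his METHOD (arXiv:1209.6043, Theorem 3 + Lemmas 7–10, in the tree's form of a verified interval-arithmetic
growth search, `Literature/…/KissingSearch*.lean`) with the largest long-side cosine `κ` made an EXPLICIT PARAMETER
(`κ : Kappa`, carrying the two numeric facts the soundness proof uses: `-1/2 ≤ κ`, `κ < 1/4`).  Only the declarations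
whose statement depends on `κ` are declared here (namespace `…Kissing125.GSearch`, the tree's short names, no renames);
every κ-free helper is the landed K25 copy (`…Kissing125.KissingSearch.*`) and every κ-free lemma is cited from the tree
(PRIVATE per-file citation aliases; `GSearchTransport.lean` holds `toT : St → tree St` and the transport equalities).  The K25
instance is `κ25 = ⟨7/32, …⟩`; `GSearchBridge.lean` identifies the generic checker at
`κ25` with the landed `Kissing125.KissingSearch.checkPart`, so the landed run files are consumed unchanged.  Generated by
`HOME/lean/kissing125/v4-prep/gen/mkgen.py`; nothing here is asserted about GAP(1.26) or any census.

THIS FILE: the κ-tainted declarations of `Literature/Geometry/DiscreteGeometry/KissingSearchDefs.lean` (part 1 of 3), with `κ : Kappa` threaded; κ-free declarations of that file are NOT re-declared publicly (the κ-free helpers are the landed K25 copies; the κ-free tree lemmas used by the proofs are cited through PRIVATE aliases at the top of the file).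

## References
* T. C. Hales, *A proof of Fejes Tóth's conjecture on sphere packings with kissing number twelve*,
  arXiv:1209.6043 (2012): Definition 1, Theorem 2, Theorem 3, Lemmas 7–10. [`Hales2012`]
* R. E. Moore, *Interval Analysis* (1966), Theorem 3.1, §4.4. [`Moore1966`]
-/

namespace Summit.Ventures.Crystal3D.Kissing125

open Literature.Geometry.DiscreteGeometry
open Summit.Ventures.Crystal3D.Kissing125.KissingSearch

namespace GSearch

open Real Literature.Analysis.ValidatedNumerics KissingLP NonemptyInterval Finset

variable {κ : Kappa}


/-! ### Part A. Numeric semantics -/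

/-- Membership of a real in the cell of a symbol. [folklore] -/
def SymMem (κ : Kappa) (σ : ℕ) (x : ℝ) : Prop := x ∈ (symIv κ σ).ratCast ℝ

/-! ### Part B. The abstract structure, its conclusion, codes, semantics, realized states -/

/-- **The local structure of a labelled fan triangulation of a kissing configuration.**  Labels
are natural numbers `< 12`; `g a b` is the inner product of the unit vectors with labels `a, b`;
`T` is the set of fan triangles (three-element sets of labels); `ang t v` is the angle of the
triangle `t` at its vertex `v` (`0` if `v ∉ t`).  The fields after `ang` are the axioms used by
the search; all of them are proved for kissing configurations in `KissingSearchGeometry.lean`.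
[cite: Hales2012, Definition 1 and proof of Theorem 3] -/
structure KConf (κ : Kappa) where
  /-- Gram entries -/
  g : ℕ → ℕ → ℝ
  /-- fan triangles -/
  T : Finset (Finset ℕ)
  /-- angle of a triangle at a vertex -/
  ang : Finset ℕ → ℕ → ℝ
  /-- symmetry of the Gram entries -/
  g_symm : ∀ a b, g a b = g b a
  /-- triangles are three labels `< 12` -/
  mem_T : ∀ t ∈ T, t.card = 3 ∧ ∀ a ∈ t, a < 12
  /-- twenty triangles -/
  card_T : T.card = 20
  /-- every side of a triangle lies in exactly two triangles -/
  two : ∀ t ∈ T, ∀ a ∈ t, ∀ b ∈ t, a ≠ b → (T.filter fun t' => a ∈ t' ∧ b ∈ t').card = 2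
  /-- contacts are sides -/
  contact_side : ∀ a b, a < 12 → b < 12 → a ≠ b → g a b = 1 / 2 → ∃ t ∈ T, a ∈ t ∧ b ∈ t
  /-- the gap: a pair is a contact or has inner product `≤ κ₀` (and `≥ -1`) -/
  dichot : ∀ a b, a < 12 → b < 12 → a ≠ b → g a b = 1 / 2 ∨ (-1 ≤ g a b ∧ g a b ≤ κR κ)
  /-- sides of triangles have inner product `> -1/2` -/
  side_bound : ∀ t ∈ T, ∀ a ∈ t, ∀ b ∈ t, a ≠ b → -(1 / 2 : ℝ) < g a b
  /-- at most four contacts at a label -/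
  cdeg_le : ∀ a, a < 12 → ((range 12).filter fun b => b ≠ a ∧ g a b = 1 / 2).card ≤ 4
  /-- at least `23` contact pairs -/
  contacts_ge : 23 ≤ (((range 12) ×ˢ (range 12)).filter fun p => p.1 < p.2 ∧ g p.1 p.2 = 1 / 2).card
  /-- node equation -/
  node : ∀ v, v < 12 → ∑ t ∈ T, ang t v = 2 * π
  /-- angles are nonnegative -/
  ang_nonneg : ∀ t v, 0 ≤ ang t v
  /-- angles are at most `π` -/
  ang_le_pi : ∀ t v, ang t v ≤ π
  /-- the angle of a triangle at a non-vertex is `0` -/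
  ang_zero : ∀ t ∈ T, ∀ v, v ∉ t → ang t v = 0
  /-- spherical law of cosines -/
  cos_law : ∀ t ∈ T, ∀ v ∈ t, ∀ a ∈ t, ∀ b ∈ t, v ≠ a → v ≠ b → a ≠ b →
    Real.cos (ang t v) * (Real.sqrt (1 - g v a ^ 2) * Real.sqrt (1 - g v b ^ 2)) = g a b - g v a * g v b
  /-- circumradius `< 60°` in polynomial form -/
  circum : ∀ t ∈ T, ∀ v ∈ t, ∀ a ∈ t, ∀ b ∈ t, v ≠ a → v ≠ b → a ≠ b → 0 < Pfun (g v a) (g v b) (g a b)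
  /-- the rhombus cap -/
  pairing : ∀ p q v w, p ≠ q → v ≠ w → ({p, q, v} : Finset ℕ) ∈ T → ({p, q, w} : Finset ℕ) ∈ T →
    g v p = 1 / 2 → g v q = 1 / 2 → g w p = 1 / 2 → g w q = 1 / 2 → 0 ≤ g p q
  /-- the link of a label is a single cycle (closure form) -/
  link : ∀ v, v < 12 → ∀ A ⊆ T.filter (fun t => v ∈ t), A.Nonempty →
    (∀ t ∈ A, ∀ t' ∈ T, v ∈ t' → (t ∩ t').card = 2 → t' ∈ A) → A = T.filter fun t => v ∈ t
  /-- the triangles connect the labels -/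
  conn : ∀ D ⊆ range 12, D.Nonempty → (∀ t ∈ T, (∃ a ∈ t, a ∈ D) → t ⊆ D) → D = range 12
  /-- every label is a vertex of a triangle -/
  cover : ∀ v, v < 12 → ∃ t ∈ T, v ∈ t

/-- **The conclusion**: the contact graph of `M` is, by a bijection of the labels, the FCC
(`tameAdjM 1`) or the HCP (`tameAdjM 0`) contact graph. [cite: Hales2012, Lemma 9] -/
def KConf.Concl (M : KConf κ) : Prop :=
  ∃ i : Fin 8, (i = 0 ∨ i = 1) ∧ ∃ e : Fin 12 ≃ Fin 12,
    ∀ a b : Fin 12, ((a : ℕ) ≠ b ∧ M.g a b = 1 / 2) ↔ tameAdjM i (e a) (e b) = true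

/-- **Meaning of a domain code** for the Gram entry `x` of its side: unlabelled (no
information), contact (`x = 1/2`), or a valid cell range enclosing `x ≠ 1/2`. [folklore] -/
def DomSem (κ : Kappa) (r : ℕ) (x : ℝ) : Prop :=
  r = UNL ∨ (r = 0 ∧ x = 1 / 2) ∨
    (ValidDom r ∧ r ≠ 0 ∧ x ≠ 1 / 2 ∧ ((gridPt κ (rLo r - 1) : ℚ) : ℝ) ≤ x ∧ x ≤ ((gridPt κ (rHi r) : ℚ) : ℝ))

/-- **A state realized by a structure.**  The placed triangles are valid codes of triangles of
`M` without repetition; the side counts are the true counts; every domain code is valid and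
means what it says about the Gram entry; labelled sides are sides of placed triangles and
conversely. [folklore] -/
structure Realizes (M : KConf κ) (s : St) : Prop where
  /-- the domain array has `144` entries -/
  size_dom : s.dom.size = 144
  /-- the side-count array has `144` entries -/
  size_sc : s.sc.size = 144
  /-- placed triangles are valid codes -/
  valid : ∀ t ∈ s.tris.toList, TriValid t
  /-- placed triangles are triangles of `M` -/
  mem : ∀ t ∈ s.tris.toList, tset t ∈ M.T
  /-- no repetition -/
  nodup : s.tris.toList.Nodup
  /-- the cached side counts are the true counts -/
  sc_eq : ∀ a b, a < 12 → b < 12 → a ≠ b →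
    s.gsc a b = (s.tris.toList.filter fun t => tmem t a && tmem t b).length
  /-- domain codes mean what they say -/
  dom : ∀ a b, a < 12 → b < 12 → a ≠ b → DomSem κ (s.gdom a b) (M.g a b)
  /-- labelled pairs are sides of placed triangles -/
  lab_side : ∀ a b, a < 12 → b < 12 → a ≠ b → s.gdom a b ≠ UNL →
    ∃ t ∈ s.tris.toList, a ∈ tset t ∧ b ∈ tset t
  /-- sides of placed triangles are labelled -/
  side_lab : ∀ t ∈ s.tris.toList, ∀ a ∈ tset t, ∀ b ∈ tset t, a ≠ b → s.gdom a b ≠ UNL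

/-! ### Part C. Auxiliary sets, relabelling, root normalisation -/

/-- The set of `M`-triangles through two labels. [folklore] -/
def KConf.onSide (M : KConf κ) (v x : ℕ) : Finset (Finset ℕ) := M.T.filter fun t => v ∈ t ∧ x ∈ t

/-- The sides of the triangles of `M` (two-element subsets). [folklore] -/
def KConf.sides (M : KConf κ) : Finset (Finset ℕ) := M.T.biUnion fun t => t.powersetCard 2

/-- The long sides (not contacts). [folklore] -/
noncomputable def KConf.longSides (M : KConf κ) : Finset (Finset ℕ) := M.sides.filter fun e => ∃ p ∈ e, ∃ q ∈ e, p ≠ q ∧ M.g p q ≠ 1 / 2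

/-- The type of a pair in `M`: `0` for a contact, `1` otherwise. [folklore] -/
noncomputable def KConf.ty (M : KConf κ) (p q : ℕ) : ℕ := if M.g p q = 1 / 2 then 0 else 1

/-- **The root normalisation** carried along the search: label `0` has exactly four contacts,
at most one long side of the triangulation, and the reflection tie-break
`(ty 0 3, ty 1 3) ≤ (ty 0 4, ty 2 4)` holds. [folklore] -/
def KConf.RootInv (M : KConf κ) : Prop :=
  ((Finset.range 12).filter fun u => u ≠ 0 ∧ M.g 0 u = 1 / 2).card = 4 ∧
  (∀ u w, ({0, u} : Finset ℕ) ∈ M.longSides → ({0, w} : Finset ℕ) ∈ M.longSides → u = w) ∧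
  ¬ (M.ty 0 4 < M.ty 0 3 ∨ (M.ty 0 3 = M.ty 0 4 ∧ M.ty 2 4 < M.ty 1 3))

/-- The true code of a pair: its present code if labelled, else contact or the full long range
according to `M`. [folklore] -/
noncomputable def trueCode (M : KConf κ) (s : St) (p q : ℕ) : ℕ :=
  if s.gdom p q ≠ UNL then s.gdom p q else if M.g p q = 1 / 2 then 0 else FULLR

/-- The contacts of a label. [folklore] -/
noncomputable def KConf.contacts (M : KConf κ) (v : ℕ) : Finset ℕ := (Finset.range 12).filter fun u => u ≠ v ∧ M.g v u = 1 / 2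

/-- The long sides through a label (as the other endpoint). [folklore] -/
noncomputable def KConf.longSpokes (M : KConf κ) (v : ℕ) : Finset ℕ := (Finset.range 12).filter fun u => ({v, u} : Finset ℕ) ∈ M.longSides

/-- **The good configuration at a root vertex**: the root `v₀`, a triangle `{v₀, p, q}` with two
contact spokes, and the further triangles `{v₀, p, p₃}`, `{v₀, q, p₄}` (`p₃ ≠ p₄`), with the
four-contacts and one-long-side conditions at `v₀`. [folklore] -/
def KConf.Good (M : KConf κ) (v₀ p q p₃ p₄ : ℕ) : Prop :=
  v₀ < 12 ∧ p < 12 ∧ q < 12 ∧ p₃ < 12 ∧ p₄ < 12 ∧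
  v₀ ≠ p ∧ v₀ ≠ q ∧ v₀ ≠ p₃ ∧ v₀ ≠ p₄ ∧ p ≠ q ∧ p ≠ p₃ ∧ p ≠ p₄ ∧ q ≠ p₃ ∧ q ≠ p₄ ∧ p₃ ≠ p₄ ∧
  M.g v₀ p = 1 / 2 ∧ M.g v₀ q = 1 / 2 ∧
  ({v₀, p, q} : Finset ℕ) ∈ M.T ∧ ({v₀, p, p₃} : Finset ℕ) ∈ M.T ∧ ({v₀, q, p₄} : Finset ℕ) ∈ M.T ∧
  (M.contacts v₀).card = 4 ∧ (∀ u w, ({v₀, u} : Finset ℕ) ∈ M.longSides → ({v₀, w} : Finset ℕ) ∈ M.longSides → u = w)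

/-- The type bits read off `M`. [folklore] -/
noncomputable def bitsOf (M : KConf κ) : ℕ := M.ty 0 3 + 2 * M.ty 1 3 + 4 * M.ty 0 4 + 8 * M.ty 2 4

/-! #### Relabelling -/

section Relabel

variable (M : KConf κ) (σ : Equiv.Perm ℕ) (hσ : ∀ a, σ a < 12 ↔ a < 12)

end Relabel

end GSearch

end Summit.Ventures.Crystal3D.Kissing125
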